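import Summits.CriticalPhenomena.PercolationContinuityZ3.Theorems.PercNearOneGluingNoHeavyQuantDIBStar
import Summits.CriticalPhenomena.PercolationContinuityZ3.Theorems.PercNearOneGluingNoHeavyQuantRootDecFloorSplit
import HarnessLib

/-!
# QUANT lane R8, Conjecture DIB\* — THE TRIPLE CERTIFICATE and DIB\* FOR EVERY SYSTEM OF AT MOST THREE BLOBS (kernel), every floor
# `1/2 ≤ x < 1`: three pairwise-completing blobs whose credit RATES sum to at least `2` force the row

builds on p205010 (kernel theorem, internal audit signed; external expert review pending)

Support file (`--supports stmt-CriticalPhenomena-4575`), QUANT lane typer seat prim-quant-stmt (gen 20), rung R8 of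
`run/shared/lean/prim/quant/LADDER.md`.  Theorems only (no definitions, no sorries, standard axioms); local notation copied verbatim from
`…QuantRootReduction`.

Conjecture DIB\* (`Quant.IndepBlob.DIBStar x`, `…QuantDIBStar`): independent blobs with sizes `a k` and gates `g k ∈ [0,1]`, floor `x`, layer `j`,
light blobs (`g k < x`) of size `≤ j`, CREDIT RATE `φ_x(g) = g` (heavy, `x ≤ g`) or `κ_x(g) = (g − x²)/(1 − x)` (light); total credit `Σ a k·φ_x(g k) > 2j`
⟹ `x ≤ P(N ≥ j+1)`.  Kernel so far: `x ≤ 1/2` (lead g15), no light blob, one light blob (census-1 g14 / p1 g11), light total `≤ j`, big lights, two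
medium lights (census-1 g15), mergeable / matched companions (p1 g11, lead g16); the lead's climbs (LEAD-NOTES-G17 N33 (3)) locate the extremal failure
ratio `sup P(N ≤ j)/(1 − x) = 7/9` on THREE tied blobs of size `j` (two or three of them light, `x → 2/3`).  This file closes that family and more:

* `Quant.IndepBlob.two_of_three_ge_floor` — **THE REAL INEQUALITY.**  `1/2 ≤ x < 1`, `g₁, g₂, g₃ ∈ [0,1]`, `φ_x(g₁) + φ_x(g₂) + φ_x(g₃) ≥ 2` ⟹
  `x ≤ P(at least two of three independent events of probabilities gᵢ) = g₁g₂ + g₁g₃ + g₂g₃ − 2g₁g₂g₃`.  In the closure coordinates `q = 1 − g`,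
  `y = 1 − x`, a heavy blob has `q ≤ y` and credit `1 − q`, a light one has `q = y·s`, `s ≥ 1`, and credit EXACTLY `2 − y − s`; the claim
  `q₁q₂ + q₁q₃ + q₂q₃ − 2q₁q₂q₃ ≤ y` is, in each of the four cases (0–3 light blobs), a polynomial inequality on a polytope, discharged by an exact
  HANDELMAN certificate (nonnegative combination of products of the linear constraints; found by LP and verified in exact arithmetic, kit j130058;
  replayed here by `linarith` over the listed products): `threeBlob_core_noLight/oneLight/twoLights/threeLights`.  Tight family: three lights with
  `s = 1`, `y = 1/3` (margin `2/9·y`, the lead's `7/9`).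
* `Quant.RootDec.term_ge_of_triple` — **THE TRIPLE CERTIFICATE (TERM rule).**  Gates in `[0,1]`; three distinct blobs `k₁, k₂, k₃`, PAIRWISE COMPLETING
  at the sure part `s` (`j + 1 ≤ s + a kᵢ + a kₗ` for the three pairs), with `φ_x(g k₁) + φ_x(g k₂) + φ_x(g k₃) ≥ 2`, `1/2 ≤ x < 1` ⟹ `x ≤ TERM[s, a, g, j]`
  — whatever the other blobs are (conditioning on the three blobs, `term_cond` thrice; the other blobs only help).  A closed-form certificate in the instance
  data, to sit beside ∨ / ∧ / α′ / ε in the menus of ARCHITECTURE FS.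
* `Quant.IndepBlob.tail_ge_of_card_le_three` — **DIB\* FOR AT MOST THREE NON-EMPTY BLOBS**, every floor `1/2 ≤ x < 1`, in `DIBWith`'s binder shape plus
  the hypothesis `#{k : 0 < a k} ≤ 3`: either a heavy giant decides alone, or all sizes are `≤ j`, the credit forces exactly three non-empty blobs,
  pairwise completing, with rates summing to `> 2`, and the triple certificate applies.  (For `x ≤ 1/2` DIB\* is kernel in general.)

NOVELTY.  presearch (2026-08-21): "probability that at least two of three independent events occur, lower bound from a budget on the marginals" /
"Handelman certificate Bernoulli" → none relevant (corpus hybrid + vsearch: Bonferroni-type inequalities S₂ − S₃ textbook pages, Hoeffding 1956 on the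
number of successes; galaxy `at least two of three|Handelman`: unrelated); the discounted rate `κ_x` is this lane's (census-2 g49).  BARRIERS: none of
`Literature/Barriers/CriticalPhenomena/…` concern finite product-measure rows.  [this work; certificates: kit j130058 (this seat)]; the gluing rows
served [cite: KozmaNitzan2024, Conjecture 3 (p. 15)]; product weights [cite: Grimmett1999, §1.3 p. 10]; Handelman's Positivstellensatz for polytopes
(D. Handelman, Pacific J. Math. 132 (1988) 35–62) is used only heuristically to FIND the certificates (the identities themselves are checked by the kernel).
-/

namespace Summit.CriticalPhenomena.PercolationContinuityZ3.Theorems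

namespace Quant

namespace IndepBlob

/-! ### 1. The four Handelman certificates (closure coordinates `qᵢ = 1 − gᵢ`, `y = 1 − x`; lights `qᵢ = y·sᵢ`) -/

/-- Certificate, no light blob (`q_i ≤ y`, credit `Σ (1 − q_i) ≥ 2`): `P(≤ 1 open) ≤ y`.  Handelman form of degree 3,
16 products (kit j130058, exact). [this work] -/
theorem threeBlob_core_noLight (y q1 q2 q3 : ℝ) (hq1 : 0 ≤ q1) (hq2 : 0 ≤ q2) (hq3 : 0 ≤ q3) (hq1y : 0 ≤ y - q1) (hq2y : 0 ≤ y - q2)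
    (hq3y : 0 ≤ y - q3) (hcr : 0 ≤ 1 - q1 - q2 - q3) :
    q1 * q2 + q1 * q3 + q2 * q3 - 2 * q1 * q2 * q3 ≤ y := by
  linarith [mul_nonneg hq1 hcr, mul_nonneg hq2 hcr, mul_nonneg hq3 hcr, mul_nonneg (mul_nonneg hq1 hq1) hq1, mul_nonneg (mul_nonneg hq1 hq1) hcr,
    mul_nonneg (mul_nonneg hq1 hq2) hq3, mul_nonneg (mul_nonneg hq1 hcr) hcr, mul_nonneg (mul_nonneg hq2 hq2) hq2,
    mul_nonneg (mul_nonneg hq2 hq2) hcr, mul_nonneg (mul_nonneg hq2 hcr) hcr, mul_nonneg (mul_nonneg hq3 hq3) hq3,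
    mul_nonneg (mul_nonneg hq3 hq3) hcr, mul_nonneg (mul_nonneg hq3 hcr) hcr]

/-- Certificate, one light blob (`q₃ = y·s₃`, `s₃ ≥ 1`, credit `(1 − q₁) + (1 − q₂) + (2 − y − s₃) ≥ 2`): `y − P(≤ 1 open) ≥ 0`.
Degree 4, 48 products (kit j130058, exact). [this work] -/
theorem threeBlob_core_oneLight (y q1 q2 s3 : ℝ) (hq1 : 0 ≤ q1) (hq2 : 0 ≤ q2) (hq1y : 0 ≤ y - q1) (hq2y : 0 ≤ y - q2) (hs3 : 0 ≤ s3 - 1)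
    (hcr : 0 ≤ 2 - y - s3 - q1 - q2) (hy : 0 ≤ y) (hyh : 0 ≤ 1 / 2 - y) :
    0 ≤ y - q1 * q2 - y * s3 * (q1 + q2) + 2 * y * s3 * q1 * q2 := by
  linarith [mul_nonneg hq1 hq2y, mul_nonneg hq1 hcr, mul_nonneg hq2 hq1y, mul_nonneg hq2 hcr, mul_nonneg hq1y hq1y, mul_nonneg hq2y hq2y,
    mul_nonneg hcr hy, mul_nonneg (mul_nonneg hq1 hq1y) hq1y, mul_nonneg (mul_nonneg hq1 hq2y) hcr, mul_nonneg (mul_nonneg hq1 hq2y) hyh,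
    mul_nonneg (mul_nonneg hq1 hs3) hcr, mul_nonneg (mul_nonneg hq1 hs3) hyh, mul_nonneg (mul_nonneg hq1 hcr) hcr,
    mul_nonneg (mul_nonneg hq2 hq1y) hcr, mul_nonneg (mul_nonneg hq2 hq2y) hq2y, mul_nonneg (mul_nonneg hq2 hs3) hyh,
    mul_nonneg (mul_nonneg hq1y hq1y) hq2y, mul_nonneg (mul_nonneg hq1y hq1y) hs3, mul_nonneg (mul_nonneg hq1y hq1y) hcr,
    mul_nonneg (mul_nonneg hq1y hq2y) hq2y, mul_nonneg (mul_nonneg hq1y hq2y) hy, mul_nonneg (mul_nonneg hq2y hq2y) hs3,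
    mul_nonneg (mul_nonneg hq2y hq2y) hcr, mul_nonneg (mul_nonneg hs3 hs3) hy, mul_nonneg (mul_nonneg hs3 hcr) hy,
    mul_nonneg (mul_nonneg hcr hcr) hy, mul_nonneg (mul_nonneg (mul_nonneg hq1 hq2y) hs3) hyh, mul_nonneg (mul_nonneg (mul_nonneg hq1 hs3) hs3) hs3,
    mul_nonneg (mul_nonneg (mul_nonneg hq1 hs3) hs3) hcr, mul_nonneg (mul_nonneg (mul_nonneg hq1 hs3) hcr) hcr,
    mul_nonneg (mul_nonneg (mul_nonneg hq2 hs3) hs3) hs3, mul_nonneg (mul_nonneg (mul_nonneg hq2 hs3) hs3) hcr,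
    mul_nonneg (mul_nonneg (mul_nonneg hq2 hs3) hcr) hcr, mul_nonneg (mul_nonneg (mul_nonneg hq1y hq1y) hq2y) hs3,
    mul_nonneg (mul_nonneg (mul_nonneg hq1y hq1y) hs3) hs3, mul_nonneg (mul_nonneg (mul_nonneg hq1y hq1y) hs3) hcr,
    mul_nonneg (mul_nonneg (mul_nonneg hq1y hq1y) hs3) hyh, mul_nonneg (mul_nonneg (mul_nonneg hq1y hq2y) hq2y) hs3,
    mul_nonneg (mul_nonneg (mul_nonneg hq1y hq2y) hs3) hy, mul_nonneg (mul_nonneg (mul_nonneg hq2y hq2y) hs3) hs3,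
    mul_nonneg (mul_nonneg (mul_nonneg hq2y hq2y) hs3) hcr, mul_nonneg (mul_nonneg (mul_nonneg hq2y hq2y) hs3) hyh,
    mul_nonneg (mul_nonneg (mul_nonneg hs3 hs3) hs3) hy, mul_nonneg (mul_nonneg (mul_nonneg hs3 hs3) hcr) hy,
    mul_nonneg (mul_nonneg (mul_nonneg hs3 hcr) hcr) hy]

/-- Certificate, two light blobs (`q_i = y·s_i`, `s_i ≥ 1` for `i = 2, 3`): `(y − P(≤ 1 open))/y ≥ 0`.  Degree 4, 38 products (kit j130058, exact). [this work] -/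
theorem threeBlob_core_twoLights (y q1 s2 s3 : ℝ) (hq1 : 0 ≤ q1) (hq1y : 0 ≤ y - q1) (hs2 : 0 ≤ s2 - 1) (hs3 : 0 ≤ s3 - 1)
    (hcr : 0 ≤ 3 - 2 * y - s2 - s3 - q1) (hy : 0 ≤ y) (hyh : 0 ≤ 1 / 2 - y) :
    0 ≤ 1 - q1 * s2 - q1 * s3 - y * s2 * s3 + 2 * q1 * y * s2 * s3 := by
  linarith [mul_nonneg hq1 hq1y, mul_nonneg hq1y hyh, mul_nonneg hs2 hs2, mul_nonneg hs2 hcr, mul_nonneg hs2 hyh, mul_nonneg hs3 hs3,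
    mul_nonneg hs3 hcr, mul_nonneg hs3 hyh, mul_nonneg hcr hyh, mul_nonneg (mul_nonneg hq1 hq1y) hq1y, mul_nonneg (mul_nonneg hq1 hq1y) hs2,
    mul_nonneg (mul_nonneg hq1 hq1y) hs3, mul_nonneg (mul_nonneg hq1 hcr) hcr, mul_nonneg (mul_nonneg hq1y hq1y) hcr,
    mul_nonneg (mul_nonneg hq1y hs2) hyh, mul_nonneg (mul_nonneg hq1y hs3) hyh, mul_nonneg (mul_nonneg hq1y hyh) hyh,
    mul_nonneg (mul_nonneg hs2 hs2) hs2, mul_nonneg (mul_nonneg hs2 hs2) hcr, mul_nonneg (mul_nonneg hs2 hs3) hcr,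
    mul_nonneg (mul_nonneg hs2 hs3) hyh, mul_nonneg (mul_nonneg hs2 hcr) hcr, mul_nonneg (mul_nonneg hs2 hcr) hyh,
    mul_nonneg (mul_nonneg hs3 hs3) hs3, mul_nonneg (mul_nonneg hs3 hs3) hcr, mul_nonneg (mul_nonneg hs3 hcr) hcr,
    mul_nonneg (mul_nonneg hs3 hcr) hyh, mul_nonneg (mul_nonneg hcr hyh) hyh, mul_nonneg (mul_nonneg (mul_nonneg hq1 hs2) hs3) hy,
    mul_nonneg (mul_nonneg (mul_nonneg hq1y hs2) hs3) hyh, mul_nonneg (mul_nonneg (mul_nonneg hs2 hs2) hs3) hyh,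
    mul_nonneg (mul_nonneg (mul_nonneg hs2 hs3) hs3) hyh, mul_nonneg (mul_nonneg (mul_nonneg hs2 hs3) hcr) hyh]

/-- Certificate, three light blobs (`q_i = y·s_i`, `s_i ≥ 1`, credit `Σ (2 − y − s_i) ≥ 2`): `(y − P(≤ 1 open))/y ≥ 0`.
Degree 5, 52 products (kit j130058, exact). [this work] -/
theorem threeBlob_core_threeLights (y s1 s2 s3 : ℝ) (hs1 : 0 ≤ s1 - 1) (hs2 : 0 ≤ s2 - 1) (hs3 : 0 ≤ s3 - 1) (hcr : 0 ≤ 4 - 3 * y - s1 - s2 - s3)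
    (hy : 0 ≤ y) (hyh : 0 ≤ 1 / 2 - y) :
    0 ≤ 1 - y * (s1 * s2 + s1 * s3 + s2 * s3) + 2 * y ^ 2 * s1 * s2 * s3 := by
  linarith [mul_nonneg hs1 hs1, mul_nonneg hs1 hcr, mul_nonneg hs1 hyh, mul_nonneg hs2 hs2, mul_nonneg hs2 hcr, mul_nonneg hs2 hyh,
    mul_nonneg hs3 hs3, mul_nonneg hs3 hcr, mul_nonneg hs3 hyh, mul_nonneg hy hy, mul_nonneg (mul_nonneg hs1 hs1) hs1,
    mul_nonneg (mul_nonneg hs1 hs1) hcr, mul_nonneg (mul_nonneg hs1 hs1) hyh, mul_nonneg (mul_nonneg hs1 hs2) hcr,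
    mul_nonneg (mul_nonneg hs1 hs3) hcr, mul_nonneg (mul_nonneg hs2 hs2) hs2, mul_nonneg (mul_nonneg hs2 hs2) hcr,
    mul_nonneg (mul_nonneg hs2 hs2) hyh, mul_nonneg (mul_nonneg hs2 hs3) hcr, mul_nonneg (mul_nonneg hs3 hs3) hs3,
    mul_nonneg (mul_nonneg hs3 hs3) hcr, mul_nonneg (mul_nonneg hs3 hs3) hyh, mul_nonneg (mul_nonneg hcr hcr) hy,
    mul_nonneg (mul_nonneg hyh hyh) hyh, mul_nonneg (mul_nonneg (mul_nonneg hs1 hs1) hs1) hy, mul_nonneg (mul_nonneg (mul_nonneg hs1 hs1) hs2) hyh,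
    mul_nonneg (mul_nonneg (mul_nonneg hs1 hs1) hs3) hyh, mul_nonneg (mul_nonneg (mul_nonneg hs1 hs1) hcr) hy,
    mul_nonneg (mul_nonneg (mul_nonneg hs1 hs2) hs2) hyh, mul_nonneg (mul_nonneg (mul_nonneg hs1 hs2) hcr) hyh,
    mul_nonneg (mul_nonneg (mul_nonneg hs1 hs2) hyh) hyh, mul_nonneg (mul_nonneg (mul_nonneg hs1 hs3) hs3) hyh,
    mul_nonneg (mul_nonneg (mul_nonneg hs1 hs3) hcr) hyh, mul_nonneg (mul_nonneg (mul_nonneg hs1 hs3) hyh) hyh,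
    mul_nonneg (mul_nonneg (mul_nonneg hs1 hcr) hcr) hy, mul_nonneg (mul_nonneg (mul_nonneg hs1 hyh) hyh) hyh,
    mul_nonneg (mul_nonneg (mul_nonneg hs2 hs2) hs2) hy, mul_nonneg (mul_nonneg (mul_nonneg hs2 hs2) hs3) hyh,
    mul_nonneg (mul_nonneg (mul_nonneg hs2 hs2) hcr) hy, mul_nonneg (mul_nonneg (mul_nonneg hs2 hs3) hs3) hyh,
    mul_nonneg (mul_nonneg (mul_nonneg hs2 hs3) hcr) hyh, mul_nonneg (mul_nonneg (mul_nonneg hs2 hs3) hyh) hyh,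
    mul_nonneg (mul_nonneg (mul_nonneg hs2 hcr) hcr) hy, mul_nonneg (mul_nonneg (mul_nonneg hs2 hyh) hyh) hyh,
    mul_nonneg (mul_nonneg (mul_nonneg hs3 hs3) hs3) hy, mul_nonneg (mul_nonneg (mul_nonneg hs3 hs3) hcr) hy,
    mul_nonneg (mul_nonneg (mul_nonneg hs3 hcr) hcr) hy, mul_nonneg (mul_nonneg (mul_nonneg hs3 hyh) hyh) hyh,
    mul_nonneg (mul_nonneg (mul_nonneg (mul_nonneg hs1 hs2) hs3) hy) hy, mul_nonneg (mul_nonneg (mul_nonneg (mul_nonneg hs1 hs2) hs3) hyh) hyh]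

/-! ### 2. At most one of three: the real inequality -/

/-- **Closure coordinates**: `0 ≤ y ≤ 1/2`, `qᵢ ≥ 0`, each blob either HEAVY (`qᵢ ≤ y`, credit `cᵢ = 1 − qᵢ`) or LIGHT (`qᵢ = y·sᵢ`, `sᵢ ≥ 1`,
credit `cᵢ = 2 − y − sᵢ`), `c₁ + c₂ + c₃ ≥ 2` ⟹ `P(at most one open) = q₁q₂ + q₁q₃ + q₂q₃ − 2q₁q₂q₃ ≤ y` (eight cases, four certificates up to
symmetry). [this work] -/
theorem atMostOne_of_three_le (y q₁ q₂ q₃ c₁ c₂ c₃ : ℝ) (hy : 0 ≤ y) (hyh : y ≤ 1 / 2)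
    (hq₁ : 0 ≤ q₁) (hq₂ : 0 ≤ q₂) (hq₃ : 0 ≤ q₃)
    (hb₁ : (q₁ ≤ y ∧ c₁ = 1 - q₁) ∨ ∃ s : ℝ, 1 ≤ s ∧ q₁ = y * s ∧ c₁ = 2 - y - s)
    (hb₂ : (q₂ ≤ y ∧ c₂ = 1 - q₂) ∨ ∃ s : ℝ, 1 ≤ s ∧ q₂ = y * s ∧ c₂ = 2 - y - s)
    (hb₃ : (q₃ ≤ y ∧ c₃ = 1 - q₃) ∨ ∃ s : ℝ, 1 ≤ s ∧ q₃ = y * s ∧ c₃ = 2 - y - s)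
    (hcr : 2 ≤ c₁ + c₂ + c₃) :
    q₁ * q₂ + q₁ * q₃ + q₂ * q₃ - 2 * q₁ * q₂ * q₃ ≤ y := by
  have hyh' : 0 ≤ 1 / 2 - y := by linarith
  rcases hb₁ with ⟨h1y, hc1⟩ | ⟨s₁, hs₁, hq1s, hc1⟩ <;> rcases hb₂ with ⟨h2y, hc2⟩ | ⟨s₂, hs₂, hq2s, hc2⟩ <;>
    rcases hb₃ with ⟨h3y, hc3⟩ | ⟨s₃, hs₃, hq3s, hc3⟩
  · -- H H H
    exact threeBlob_core_noLight y q₁ q₂ q₃ hq₁ hq₂ hq₃ (by linarith) (by linarith) (by linarith) (by linarith)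
  · -- H H L
    subst hq3s
    have key := threeBlob_core_oneLight y q₁ q₂ s₃ hq₁ hq₂ (by linarith) (by linarith) (by linarith) (by linarith) hy hyh'
    linarith
  · -- H L H
    subst hq2s
    have key := threeBlob_core_oneLight y q₁ q₃ s₂ hq₁ hq₃ (by linarith) (by linarith) (by linarith) (by linarith) hy hyh'
    linarith
  · -- H L L
    subst hq2s; subst hq3s
    have key := threeBlob_core_twoLights y q₁ s₂ s₃ hq₁ (by linarith) (by linarith) (by linarith) (by linarith) hy hyh'
    linarith [mul_nonneg hy key]
  · -- L H H
    subst hq1s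
    have key := threeBlob_core_oneLight y q₂ q₃ s₁ hq₂ hq₃ (by linarith) (by linarith) (by linarith) (by linarith) hy hyh'
    linarith
  · -- L H L
    subst hq1s; subst hq3s
    have key := threeBlob_core_twoLights y q₂ s₁ s₃ hq₂ (by linarith) (by linarith) (by linarith) (by linarith) hy hyh'
    linarith [mul_nonneg hy key]
  · -- L L H
    subst hq1s; subst hq2s
    have key := threeBlob_core_twoLights y q₃ s₁ s₂ hq₃ (by linarith) (by linarith) (by linarith) (by linarith) hy hyh'
    linarith [mul_nonneg hy key]
  · -- L L L
    subst hq1s; subst hq2s; subst hq3s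
    have key := threeBlob_core_threeLights y s₁ s₂ s₃ (by linarith) (by linarith) (by linarith) (by linarith) hy hyh'
    linarith [mul_nonneg hy key]

/-- **A blob is heavy or light, in closure coordinates.**  For `x < 1`: either `x ≤ g`, `1 − g ≤ 1 − x` and the credit rate
`φ_x(g)` is `1 − (1 − g)`; or `g < x` and `1 − g = (1 − x)·s` with `s ≥ 1` and `φ_x(g) = κ_x(g) = 2 − (1 − x) − s`. [this work] -/
theorem blob_alt (x g : ℝ) (hx1 : x < 1) :
    ((1 - g ≤ 1 - x ∧ (if x ≤ g then g else (g - x ^ 2) / (1 - x)) = 1 - (1 - g)) ∨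
      ∃ s : ℝ, 1 ≤ s ∧ 1 - g = (1 - x) * s ∧ (if x ≤ g then g else (g - x ^ 2) / (1 - x)) = 2 - (1 - x) - s) := by
  by_cases h : x ≤ g
  · left
    refine ⟨by linarith, ?_⟩
    rw [if_pos h]; ring
  · right
    have hxg : g < x := not_le.1 h
    have h1x : 0 < 1 - x := by linarith
    refine ⟨(1 - g) / (1 - x), ?_, ?_, ?_⟩
    · rw [le_div_iff₀ h1x]; linarith
    · field_simp
    · rw [if_neg h]; field_simp; ring

/-- **THE REAL INEQUALITY — at least two of three.**  `1/2 ≤ x < 1`, `g₁, g₂, g₃ ∈ [0,1]`, credit rates `φ_x(gᵢ) = gᵢ` if `x ≤ gᵢ`, else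
`(gᵢ − x²)/(1 − x)`, with `φ_x(g₁) + φ_x(g₂) + φ_x(g₃) ≥ 2` ⟹ `x ≤ g₁g₂ + g₁g₃ + g₂g₃ − 2g₁g₂g₃` (the probability that at least two of three
independent events of probabilities `gᵢ` occur).  Margin `≥ (2/9)(1 − x)`-tight family: `g₁ = g₂ = g₃ ↓ x = 2/3`. [this work] -/
theorem two_of_three_ge_floor (x g₁ g₂ g₃ : ℝ) (hx : 1 / 2 ≤ x) (hx1 : x < 1)
    (h₁ : 0 ≤ g₁ ∧ g₁ ≤ 1) (h₂ : 0 ≤ g₂ ∧ g₂ ≤ 1) (h₃ : 0 ≤ g₃ ∧ g₃ ≤ 1)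
    (hcr : 2 ≤ (if x ≤ g₁ then g₁ else (g₁ - x ^ 2) / (1 - x)) + (if x ≤ g₂ then g₂ else (g₂ - x ^ 2) / (1 - x)) +
      (if x ≤ g₃ then g₃ else (g₃ - x ^ 2) / (1 - x))) :
    x ≤ g₁ * g₂ + g₁ * g₃ + g₂ * g₃ - 2 * g₁ * g₂ * g₃ := by
  have key := atMostOne_of_three_le (1 - x) (1 - g₁) (1 - g₂) (1 - g₃)
    (if x ≤ g₁ then g₁ else (g₁ - x ^ 2) / (1 - x)) (if x ≤ g₂ then g₂ else (g₂ - x ^ 2) / (1 - x))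
    (if x ≤ g₃ then g₃ else (g₃ - x ^ 2) / (1 - x)) (by linarith) (by linarith) (by linarith [h₁.2]) (by linarith [h₂.2])
    (by linarith [h₃.2]) (blob_alt x g₁ hx1) (blob_alt x g₂ hx1) (blob_alt x g₃ hx1) hcr
  linarith

end IndepBlob

namespace RootDec

open Finset

variable {κ : Type} [Fintype κ] [DecidableEq κ]

/-- product-Bernoulli weight of the set `W` of open blobs (as in `…QuantRootReduction`) -/
local notation3 "wt[" g ", " W "]" => ∏ k, (if k ∈ (W : Finset κ) then (g : κ → ℝ) k else 1 - (g : κ → ℝ) k)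

/-- the TERM tail `P(s + Σ_{k open} a k ≥ j+1)` (as in `…QuantRootReduction`) -/
local notation3 "TERM[" s ", " a ", " g ", " j "]" =>
  ∑ W : Finset κ, wt[g, W] * (if (j : ℕ) + 1 ≤ (s : ℕ) + ∑ k ∈ W, (a : κ → ℕ) k then (1 : ℝ) else 0)

/-! ### 3. The triple certificate (TERM rule) -/

/-- **Three pairwise-completing blobs bound the term by `P(at least two of them open)`** (gates in `[0,1]`; conditioning on the three
blobs, `term_cond`; the remaining blobs only help). [this work] -/
theorem term_ge_twoOfThree (s : ℕ) (a : κ → ℕ) (g : κ → ℝ) (j : ℕ) (hg : ∀ k, 0 ≤ g k ∧ g k ≤ 1)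
    (k₁ k₂ k₃ : κ) (h12 : k₁ ≠ k₂) (h13 : k₁ ≠ k₃) (h23 : k₂ ≠ k₃)
    (hp12 : j + 1 ≤ s + a k₁ + a k₂) (hp13 : j + 1 ≤ s + a k₁ + a k₃) (hp23 : j + 1 ≤ s + a k₂ + a k₃) :
    g k₁ * g k₂ + g k₁ * g k₃ + g k₂ * g k₃ - 2 * g k₁ * g k₂ * g k₃ ≤ TERM[s, a, g, j] := by
  have e12 : Function.update a k₁ 0 k₂ = a k₂ := Function.update_of_ne h12.symm _ _
  have e13 : Function.update a k₁ 0 k₃ = a k₃ := Function.update_of_ne h13.symm _ _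
  have e123 : Function.update (Function.update a k₁ 0) k₂ 0 k₃ = a k₃ := by
    rw [Function.update_of_ne h23.symm, e13]
  -- open branch of `k₁`: `TERM[s + a k₁, a[k₁ ↦ 0]] ≥ g k₂ + (1 − g k₂)·g k₃`
  have hA3 : g k₃ ≤ TERM[s + a k₁, Function.update (Function.update a k₁ 0) k₂ 0, g, j] :=
    gate_le_term_of_giant (s + a k₁) _ g j hg k₃ (by rw [e123]; omega)
  have hA : g k₂ + (1 - g k₂) * g k₃ ≤ TERM[s + a k₁, Function.update a k₁ 0, g, j] := by
    rw [term_cond (s + a k₁) (Function.update a k₁ 0) g j k₂,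
      term_eq_one_of_sure (s + a k₁ + Function.update a k₁ 0 k₂) _ g j (by rw [e12]; omega), mul_one]
    have h := mul_le_mul_of_nonneg_left hA3 (sub_nonneg.2 (hg k₂).2)
    linarith
  -- closed branch of `k₁`: `TERM[s, a[k₁ ↦ 0]] ≥ g k₂·g k₃`
  have hB3 : g k₃ ≤ TERM[s + Function.update a k₁ 0 k₂, Function.update (Function.update a k₁ 0) k₂ 0, g, j] :=
    gate_le_term_of_giant (s + Function.update a k₁ 0 k₂) _ g j hg k₃ (by rw [e12, e123]; omega)
  have hB : g k₂ * g k₃ ≤ TERM[s, Function.update a k₁ 0, g, j] := by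
    rw [term_cond s (Function.update a k₁ 0) g j k₂]
    have h1 := mul_le_mul_of_nonneg_left hB3 (hg k₂).1
    have h2 := mul_nonneg (sub_nonneg.2 (hg k₂).2)
      (term_nonneg s (Function.update (Function.update a k₁ 0) k₂ 0) g j hg)
    linarith
  rw [term_cond s a g j k₁]
  have h1 := mul_le_mul_of_nonneg_left hA (hg k₁).1
  have h2 := mul_le_mul_of_nonneg_left hB (sub_nonneg.2 (hg k₁).2)
  linarith

/-- **THE TRIPLE CERTIFICATE.**  Gates in `[0,1]`, floor `1/2 ≤ x < 1`; three distinct blobs `k₁, k₂, k₃`, pairwise completing at the sure part `s`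
(`j + 1 ≤ s + a kᵢ + a kₗ`), whose credit rates (`g` if `x ≤ g`, else `(g − x²)/(1 − x)`) sum to at least `2` ⟹ `x ≤ TERM[s, a, g, j]`. [this work] -/
theorem term_ge_of_triple (s : ℕ) (a : κ → ℕ) (g : κ → ℝ) (j : ℕ) (hg : ∀ k, 0 ≤ g k ∧ g k ≤ 1)
    (k₁ k₂ k₃ : κ) (h12 : k₁ ≠ k₂) (h13 : k₁ ≠ k₃) (h23 : k₂ ≠ k₃)
    (hp12 : j + 1 ≤ s + a k₁ + a k₂) (hp13 : j + 1 ≤ s + a k₁ + a k₃) (hp23 : j + 1 ≤ s + a k₂ + a k₃)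
    (x : ℝ) (hx : 1 / 2 ≤ x) (hx1 : x < 1)
    (hcr : 2 ≤ (if x ≤ g k₁ then g k₁ else (g k₁ - x ^ 2) / (1 - x)) + (if x ≤ g k₂ then g k₂ else (g k₂ - x ^ 2) / (1 - x)) +
      (if x ≤ g k₃ then g k₃ else (g k₃ - x ^ 2) / (1 - x))) :
    x ≤ TERM[s, a, g, j] :=
  (IndepBlob.two_of_three_ge_floor x (g k₁) (g k₂) (g k₃) hx hx1 (hg k₁) (hg k₂) (hg k₃) hcr).trans
    (term_ge_twoOfThree s a g j hg k₁ k₂ k₃ h12 h13 h23 hp12 hp13 hp23)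

end RootDec

namespace IndepBlob

open Finset

/-! ### 4. DIB\* for at most three non-empty blobs -/

/-- The credit rate is at most one (`x < 1`, `g ≤ 1`). [this work] -/
theorem creditRate_le_one (x g : ℝ) (hx1 : x < 1) (hg1 : g ≤ 1) :
    (if x ≤ g then g else (g - x ^ 2) / (1 - x)) ≤ 1 := by
  by_cases h : x ≤ g
  · rw [if_pos h]; exact hg1
  · rw [if_neg h, div_le_one (by linarith)]
    nlinarith [not_le.1 h]

/-- **DIB\* FOR EVERY SYSTEM WITH AT MOST THREE NON-EMPTY BLOBS, every floor `1/2 ≤ x < 1`.**  Gates in `[0,1]`, light blobs (`g k < x`) of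
size `≤ j`, credit `Σ a k·φ_x(g k) > 2j`, and `#{k : 0 < a k} ≤ 3` ⟹ `x ≤ P(N ≥ j+1)`.  Either a heavy giant decides alone, or all sizes are `≤ j`,
so the credit forces three non-empty blobs, pairwise completing, with rates summing to more than `2`, and `RootDec.term_ge_of_triple` applies. [this work] -/
theorem tail_ge_of_card_le_three (x : ℝ) (hx : 1 / 2 ≤ x) (hx1 : x < 1) {ι : Type} [Fintype ι] [DecidableEq ι]
    (a : ι → ℕ) (g : ι → ℝ) (j : ℕ) (hg : ∀ k, 0 ≤ g k ∧ g k ≤ 1) (hlight : ∀ k, g k < x → a k ≤ j)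
    (hcredit : (2 * j : ℝ) < ∑ k, (a k : ℝ) * (if x ≤ g k then g k else (g k - x ^ 2) / (1 - x)))
    (hcard : (Finset.univ.filter (fun k => 0 < a k)).card ≤ 3) :
    x ≤ ∑ W : Finset ι, (∏ k, if k ∈ W then g k else 1 - g k) * (if j + 1 ≤ ∑ k ∈ W, a k then (1 : ℝ) else 0) := by
  -- the tail is the term with sure part `0`
  have hT : (∑ W : Finset ι, (∏ k, if k ∈ W then g k else 1 - g k) * (if j + 1 ≤ 0 + ∑ k ∈ W, a k then (1 : ℝ) else 0)) =
      ∑ W : Finset ι, (∏ k, if k ∈ W then g k else 1 - g k) * (if j + 1 ≤ ∑ k ∈ W, a k then (1 : ℝ) else 0) :=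
    Finset.sum_congr rfl fun W _ => by rw [zero_add]
  by_cases hgiant : ∃ k, x ≤ g k ∧ j + 1 ≤ a k
  · obtain ⟨k, hxk, hk⟩ := hgiant
    have h := RootDec.gate_le_term_of_giant 0 a g j hg k (by omega)
    rw [hT] at h
    exact hxk.trans h
  push Not at hgiant
  have hsize : ∀ k, a k ≤ j := fun k => by
    by_cases h : g k < x
    · exact hlight k h
    · exact Nat.lt_succ_iff.1 (hgiant k (not_lt.1 h))
  -- abbreviation for the rates
  set φ : ι → ℝ := fun k => if x ≤ g k then g k else (g k - x ^ 2) / (1 - x) with hφ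
  have hφ1 : ∀ k, φ k ≤ 1 := fun k => creditRate_le_one x (g k) hx1 (hg k).2
  have hterm1 : ∀ k, (a k : ℝ) * φ k ≤ a k := fun k => mul_le_of_le_one_right (Nat.cast_nonneg _) (hφ1 k)
  have haj : ∀ k, (a k : ℝ) ≤ j := fun k => by exact_mod_cast hsize k
  have hterm : ∀ k, (a k : ℝ) * φ k ≤ j := fun k => (hterm1 k).trans (haj k)
  -- the credit lives on the non-empty blobs
  set T := Finset.univ.filter (fun k => 0 < a k) with hTdef
  have hsumT : ∑ k, (a k : ℝ) * φ k = ∑ k ∈ T, (a k : ℝ) * φ k := by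
    refine (Finset.sum_subset (Finset.filter_subset _ _) fun k _ hk => ?_).symm
    have hk0 : a k = 0 := by
      have : ¬ 0 < a k := fun h => hk (Finset.mem_filter.2 ⟨Finset.mem_univ k, h⟩)
      omega
    rw [hk0, Nat.cast_zero, zero_mul]
  have hcreditT : (2 * j : ℝ) < ∑ k ∈ T, (a k : ℝ) * φ k := by rw [← hsumT]; exact hcredit
  -- hence exactly three non-empty blobs
  have hcard3 : T.card = 3 := by
    refine le_antisymm hcard ?_
    by_contra hlt
    have hle2 : (T.card : ℝ) ≤ 2 := by exact_mod_cast (show T.card ≤ 2 by omega)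
    have hbound : ∑ k ∈ T, (a k : ℝ) * φ k ≤ T.card • (j : ℝ) := Finset.sum_le_card_nsmul T _ _ fun k _ => hterm k
    rw [nsmul_eq_mul] at hbound
    have hj0 : (0 : ℝ) ≤ j := Nat.cast_nonneg j
    nlinarith
  obtain ⟨k₁, k₂, k₃, h12, h13, h23, hT3⟩ := Finset.card_eq_three.1 hcard3
  have hsum3 : ∑ k ∈ T, (a k : ℝ) * φ k = (a k₁ : ℝ) * φ k₁ + ((a k₂ : ℝ) * φ k₂ + (a k₃ : ℝ) * φ k₃) := by
    rw [hT3, Finset.sum_insert (by simp [h12, h13]), Finset.sum_insert (by simp [h23]), Finset.sum_singleton]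
  rw [hsum3] at hcreditT
  have hpos₁ : 0 < a k₁ := (Finset.mem_filter.1 (hT3 ▸ by simp : k₁ ∈ T)).2
  have hjpos : (0 : ℝ) < j := by exact_mod_cast (lt_of_lt_of_le hpos₁ (hsize k₁))
  -- every rate is nonnegative (else the other two blobs would carry more than `2j`)
  have hφpos : ∀ k k' k'' : ι, (2 * j : ℝ) < (a k : ℝ) * φ k + ((a k' : ℝ) * φ k' + (a k'' : ℝ) * φ k'') → 0 ≤ φ k := by
    intro k k' k'' h
    by_contra hneg
    have hφk : φ k ≤ 0 := (not_le.1 hneg).le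
    have h0 : (a k : ℝ) * φ k ≤ 0 := mul_nonpos_iff.2 (Or.inl ⟨Nat.cast_nonneg _, hφk⟩)
    linarith [hterm k', hterm k'']
  have hφ₁ : 0 ≤ φ k₁ := hφpos k₁ k₂ k₃ hcreditT
  have hφ₂ : 0 ≤ φ k₂ := hφpos k₂ k₁ k₃ (by linarith)
  have hφ₃ : 0 ≤ φ k₃ := hφpos k₃ k₁ k₂ (by linarith)
  -- pairwise completion
  have hp12 : j + 1 ≤ 0 + a k₁ + a k₂ := by
    have h : (j : ℝ) < a k₁ + a k₂ := by linarith [hterm1 k₁, hterm1 k₂, hterm k₃]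
    have h' : j < a k₁ + a k₂ := by exact_mod_cast h
    omega
  have hp13 : j + 1 ≤ 0 + a k₁ + a k₃ := by
    have h : (j : ℝ) < a k₁ + a k₃ := by linarith [hterm1 k₁, hterm1 k₃, hterm k₂]
    have h' : j < a k₁ + a k₃ := by exact_mod_cast h
    omega
  have hp23 : j + 1 ≤ 0 + a k₂ + a k₃ := by
    have h : (j : ℝ) < a k₂ + a k₃ := by linarith [hterm1 k₂, hterm1 k₃, hterm k₁]
    have h' : j < a k₂ + a k₃ := by exact_mod_cast h
    omega
  -- the rates sum to more than two
  have hcr : 2 ≤ φ k₁ + φ k₂ + φ k₃ := by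
    have h : (j : ℝ) * 2 < j * (φ k₁ + φ k₂ + φ k₃) := by
      nlinarith [mul_nonneg (sub_nonneg.2 (haj k₁)) hφ₁, mul_nonneg (sub_nonneg.2 (haj k₂)) hφ₂,
        mul_nonneg (sub_nonneg.2 (haj k₃)) hφ₃]
    exact (lt_of_mul_lt_mul_left h hjpos.le).le
  have key := RootDec.term_ge_of_triple 0 a g j hg k₁ k₂ k₃ h12 h13 h23 hp12 hp13 hp23 x hx hx1 hcr
  rw [hT] at key
  exact key

end IndepBlob

end Quant

end Summit.CriticalPhenomena.PercolationContinuityZ3.Theorems
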